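import Summits.ResolutionOfSingularities.ResolutionOfSingularities.Theorems.FrobeniusLadderFInjectiveMacaulayficationRMonoidFreeDefs
import Summits.ResolutionOfSingularities.ResolutionOfSingularities.Theorems.WildQuotientsWildQuotientResolutionToricChartWords
import HarnessLib

/-!
# T-TOR IN-HOUSE for the recurrent-monoid bed, (FREE′) half 1: the STRAIGHTENING TABLE — `k[R]` is spanned over `k[θ]` by the five basis monomials
# (crux `FInjectiveMacaulayfication` stmt-ResolutionOfSingularities-15315, chain w45a; res-L1-w45a-plan-1 R23.13 (2) + GO 06:28:28Z «(CM) = (FREE′)»;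
# seat res-L1-w45a-lead-1 g13; data `…RMonoidFreeDefs`)

[OURS · L1 W4.5a] Support file (`--supports stmt-ResolutionOfSingularities-15315 --as helper`); def-free; UNCONDITIONAL; no named fact; NOT a statement
of any manuscript; replaces the role of NO printed item. AI-written (AI review is weaker than expert review). Nothing of the crux is proved here.

`k[R] = ToricChart.Ring k PEmpty RMonoidDefs.rDatum ≅ k[x₁, x₃, x₄, x₂x₃x₄, x₂x₄², x₁x₂x₄, x₁x₂x₃]`, `θ = (x₁+x₂x₃x₄, x₃+x₂x₄², x₄+x₁x₂x₃, x₁x₂x₄)`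
(`RMonoidFreeDefs.thetaFun`), `B = (1, x₁x₂x₃, x₂x₃x₄, x₁x₂²x₃²x₄, x₂x₄²)` (`bElem`, degrees `bDeg = (0,1,1,2,1)`). For `t : ℕ` let
`M_t := span_k {θ^a · bElem i : |a| + bDeg i = t} ⊆ k[R]` (written inline).
* §1 word arithmetic: `wordExp_wordOf`, `theta_wordOf`, `wordElem_wordOf_add`, `thetaPow_add`, generators of `M_t`;
* §2 `θ` of the data; §3 ★ the 35 STRAIGHTENING IDENTITIES `bElem i · symElem j = Σ ± θ^b · bElem i′` (`|b| = bDeg i + 1 − bDeg i′`; lead-1 g13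
  `comp/table.py`, tri-2 g21 l.85981; each checked by `θ`-injectivity + `ring` in `k[x₁..x₄]`);
* the consequences (memberships `bElem i · symElem j ∈ M_{bDeg i+1}`, `M_t · symElem j ⊆ M_{t+1}`, and ★★ SPANNING «every monomial of degree `t` lies in
  `M_t`», i.e. `k[R] = Σᵢ k[θ] · bElem i`) are in the companion file `…RMonoidSpanning`; linear independence in `…RMonoidFreeBasis`.
[folklore; cite: BrunsHerzog1998, Thm. 2.1.2 (context: Hironaka's criterion / free over a Noether normalisation)]
-/

-- single-problem summit: the doubled namespace component is forced
set_option linter.dupNamespace false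

noncomputable section

open MvPolynomial

namespace Summit.ResolutionOfSingularities.ResolutionOfSingularities.Theorems.FInjectiveMacaulayfication.RMonoidStraightening

open Summit.ResolutionOfSingularities.ResolutionOfSingularities.Theorems.FInjectiveMacaulayfication RMonoidFreeDefs
open Summit.ResolutionOfSingularities.ResolutionOfSingularities.Theorems.WildQuotientResolution.ToricChart

variable (k : Type) [Field k]

/-! ## §1 Word arithmetic -/

/-- The exponent of `wordOf m` in closed form. [OURS · computation] -/
theorem wordExp_wordOf (m : Fin 7 → ℕ) :
    wordExp RMonoidDefs.rDatum (wordOf m) = ![m 0 + m 5 + m 6, m 3 + m 4 + m 5 + m 6, m 1 + m 3 + m 6, m 2 + m 3 + 2 * m 4 + m 5] := by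
  funext s
  fin_cases s <;> simp [wordExp, RMonoidDefs.rDatum, fsum, wordOf] <;> ring

/-- `θ (wordElem (wordOf m))` is the monomial `x₁^{m₀+m₅+m₆} x₂^{m₃+m₄+m₅+m₆} x₃^{m₁+m₃+m₆} x₄^{m₂+m₃+2m₄+m₅}`. [OURS · computation] -/
theorem theta_wordOf (m : Fin 7 → ℕ) :
    theta (wordElem k PEmpty RMonoidDefs.rDatum (wordOf m)) =
      X (Sum.inl 0) ^ (m 0 + m 5 + m 6) * X (Sum.inl 1) ^ (m 3 + m 4 + m 5 + m 6) * X (Sum.inl 2) ^ (m 1 + m 3 + m 6) *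
        X (Sum.inl 3) ^ (m 2 + m 3 + 2 * m 4 + m 5) := by
  rw [theta_wordElem, wordExp_wordOf, xmon, Fin.prod_univ_four]
  simp

/-- `wordElem (wordOf (m + m′)) = wordElem (wordOf m) · wordElem (wordOf m′)`. [OURS · computation] -/
theorem wordElem_wordOf_add (m m' : Fin 7 → ℕ) :
    wordElem k PEmpty RMonoidDefs.rDatum (wordOf (m + m')) =
      wordElem k PEmpty RMonoidDefs.rDatum (wordOf m) * wordElem k PEmpty RMonoidDefs.rDatum (wordOf m') := by
  rw [← wordElem_addW]
  apply wordElem_eq_of_wordExp_eq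
  rw [wordExp_addW, wordExp_wordOf, wordExp_wordOf, wordExp_wordOf]
  funext s
  fin_cases s <;> simp <;> ring

/-- `θ^{a+b} = θ^a θ^b`. [plumbing] -/
theorem thetaPow_add (a b : Fin 4 → ℕ) : thetaPow k (a + b) = thetaPow k a * thetaPow k b := by
  simp only [thetaPow, Pi.add_apply, pow_add, Finset.prod_mul_distrib]

/-- `θ^0 = 1`. [plumbing] -/
theorem thetaPow_zero : thetaPow k 0 = 1 := by
  simp [thetaPow]

/-- Generators of `M_t`: `θ^a · bElem i ∈ M_t` when `|a| + bDeg i = t`. [plumbing] -/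
theorem gen_mem (i : Fin 5) (a : Fin 4 → ℕ) (t : ℕ) (h : (∑ s, a s) + bDeg i = t) :
    thetaPow k a * bElem k i ∈ Submodule.span k
      {x | ∃ (i' : Fin 5) (a' : Fin 4 → ℕ), (∑ s, a' s) + bDeg i' = t ∧ x = thetaPow k a' * bElem k i'} :=
  Submodule.subset_span ⟨i, a, h, rfl⟩

/-! ## §2 `θ` of the certificate data (per index, in `simp`-ready form) -/

/-- `θ(symElem 0) = x₁`. [OURS · computation] -/
theorem theta_symElem_0 : theta (symElem k 0) = (X (Sum.inl 0) : MvPolynomial (Fin 4 ⊕ PEmpty) k) := by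
  rw [symElem, theta_wordOf]; simp

/-- `θ(symElem 1) = x₃`. [OURS · computation] -/
theorem theta_symElem_1 : theta (symElem k 1) = (X (Sum.inl 2) : MvPolynomial (Fin 4 ⊕ PEmpty) k) := by
  rw [symElem, theta_wordOf]; simp

/-- `θ(symElem 2) = x₄`. [OURS · computation] -/
theorem theta_symElem_2 : theta (symElem k 2) = (X (Sum.inl 3) : MvPolynomial (Fin 4 ⊕ PEmpty) k) := by
  rw [symElem, theta_wordOf]; simp

/-- `θ(symElem 3) = x₂x₃x₄`. [OURS · computation] -/
theorem theta_symElem_3 : theta (symElem k 3) = (X (Sum.inl 1) * X (Sum.inl 2) * X (Sum.inl 3) : MvPolynomial (Fin 4 ⊕ PEmpty) k) := by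
  rw [symElem, theta_wordOf]; simp

/-- `θ(symElem 4) = x₂x₄²`. [OURS · computation] -/
theorem theta_symElem_4 : theta (symElem k 4) = (X (Sum.inl 1) * X (Sum.inl 3) ^ 2 : MvPolynomial (Fin 4 ⊕ PEmpty) k) := by
  rw [symElem, theta_wordOf]; simp

/-- `θ(symElem 5) = x₁x₂x₄`. [OURS · computation] -/
theorem theta_symElem_5 : theta (symElem k 5) = (X (Sum.inl 0) * X (Sum.inl 1) * X (Sum.inl 3) : MvPolynomial (Fin 4 ⊕ PEmpty) k) := by
  rw [symElem, theta_wordOf]; simp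

/-- `θ(symElem 6) = x₁x₂x₃`. [OURS · computation] -/
theorem theta_symElem_6 : theta (symElem k 6) = (X (Sum.inl 0) * X (Sum.inl 1) * X (Sum.inl 2) : MvPolynomial (Fin 4 ⊕ PEmpty) k) := by
  rw [symElem, theta_wordOf]; simp

/-- `θ(bElem 0) = 1`. [OURS · computation] -/
theorem theta_bElem_0 : theta (bElem k 0) = (1 : MvPolynomial (Fin 4 ⊕ PEmpty) k) := by
  rw [bElem, theta_wordOf]; simp [bMult]

/-- `θ(bElem 1) = x₁x₂x₃`. [OURS · computation] -/
theorem theta_bElem_1 : theta (bElem k 1) = (X (Sum.inl 0) * X (Sum.inl 1) * X (Sum.inl 2) : MvPolynomial (Fin 4 ⊕ PEmpty) k) := by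
  rw [bElem, theta_wordOf]; simp [bMult]

/-- `θ(bElem 2) = x₂x₃x₄`. [OURS · computation] -/
theorem theta_bElem_2 : theta (bElem k 2) = (X (Sum.inl 1) * X (Sum.inl 2) * X (Sum.inl 3) : MvPolynomial (Fin 4 ⊕ PEmpty) k) := by
  rw [bElem, theta_wordOf]; simp [bMult]

/-- `θ(bElem 3) = x₁x₂²x₃²x₄`. [OURS · computation] -/
theorem theta_bElem_3 : theta (bElem k 3) = (X (Sum.inl 0) * X (Sum.inl 1) ^ 2 * X (Sum.inl 2) ^ 2 * X (Sum.inl 3) : MvPolynomial (Fin 4 ⊕ PEmpty) k) := by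
  rw [bElem, theta_wordOf]; simp [bMult]

/-- `θ(bElem 4) = x₂x₄²`. [OURS · computation] -/
theorem theta_bElem_4 : theta (bElem k 4) = (X (Sum.inl 1) * X (Sum.inl 3) ^ 2 : MvPolynomial (Fin 4 ⊕ PEmpty) k) := by
  rw [bElem, theta_wordOf]; simp [bMult]

/-- `θ(θ_0)`. [OURS · computation] -/
theorem theta_thetaFun_0 : theta (thetaFun k 0) = (X (Sum.inl 0) + X (Sum.inl 1) * X (Sum.inl 2) * X (Sum.inl 3) : MvPolynomial (Fin 4 ⊕ PEmpty) k) := by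
  simp [thetaFun, theta_symElem_0, theta_symElem_3]

/-- `θ(θ_1)`. [OURS · computation] -/
theorem theta_thetaFun_1 : theta (thetaFun k 1) = (X (Sum.inl 2) + X (Sum.inl 1) * X (Sum.inl 3) ^ 2 : MvPolynomial (Fin 4 ⊕ PEmpty) k) := by
  simp [thetaFun, theta_symElem_1, theta_symElem_4]

/-- `θ(θ_2)`. [OURS · computation] -/
theorem theta_thetaFun_2 : theta (thetaFun k 2) = (X (Sum.inl 3) + X (Sum.inl 0) * X (Sum.inl 1) * X (Sum.inl 2) : MvPolynomial (Fin 4 ⊕ PEmpty) k) := by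
  simp [thetaFun, theta_symElem_2, theta_symElem_6]

/-- `θ(θ_3)`. [OURS · computation] -/
theorem theta_thetaFun_3 : theta (thetaFun k 3) = (X (Sum.inl 0) * X (Sum.inl 1) * X (Sum.inl 3) : MvPolynomial (Fin 4 ⊕ PEmpty) k) := by
  simp [thetaFun, theta_symElem_5]

/-- `θ^a` written out. [plumbing] -/
theorem thetaPow_explicit (a₀ a₁ a₂ a₃ : ℕ) :
    thetaPow k ![a₀, a₁, a₂, a₃] = thetaFun k 0 ^ a₀ * thetaFun k 1 ^ a₁ * thetaFun k 2 ^ a₂ * thetaFun k 3 ^ a₃ := by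
  simp [thetaPow, Fin.prod_univ_four]


/-! ## §3 The 35 straightening identities `bElem i · symElem j = Σ ± θ^b · bElem i′` (lead-1 g13 `comp/table.py`; all coefficients ±1) -/

/-- `1 · x₁` in the basis. [OURS · computation] -/
theorem straight_0_0 : bElem k 0 * symElem k 0 = thetaPow k ![1, 0, 0, 0] * bElem k 0 - thetaPow k ![0, 0, 0, 0] * bElem k 2 := by
  apply theta_injective
  simp only [map_mul, map_pow, map_sub, thetaPow_explicit, theta_bElem_0, theta_bElem_2, theta_symElem_0, theta_thetaFun_0, theta_thetaFun_1, theta_thetaFun_2, theta_thetaFun_3]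
  ring

/-- `1 · x₃` in the basis. [OURS · computation] -/
theorem straight_0_1 : bElem k 0 * symElem k 1 = thetaPow k ![0, 1, 0, 0] * bElem k 0 - thetaPow k ![0, 0, 0, 0] * bElem k 4 := by
  apply theta_injective
  simp only [map_mul, map_pow, map_sub, thetaPow_explicit, theta_bElem_0, theta_bElem_4, theta_symElem_1, theta_thetaFun_0, theta_thetaFun_1, theta_thetaFun_2, theta_thetaFun_3]
  ring

/-- `1 · x₄` in the basis. [OURS · computation] -/
theorem straight_0_2 : bElem k 0 * symElem k 2 = thetaPow k ![0, 0, 1, 0] * bElem k 0 - thetaPow k ![0, 0, 0, 0] * bElem k 1 := by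
  apply theta_injective
  simp only [map_mul, map_pow, map_sub, thetaPow_explicit, theta_bElem_0, theta_bElem_1, theta_symElem_2, theta_thetaFun_0, theta_thetaFun_1, theta_thetaFun_2, theta_thetaFun_3]
  ring

/-- `1 · x₂x₃x₄` in the basis. [OURS · computation] -/
theorem straight_0_3 : bElem k 0 * symElem k 3 = thetaPow k ![0, 0, 0, 0] * bElem k 2 := by
  apply theta_injective
  simp only [map_mul, map_pow, thetaPow_explicit, theta_bElem_0, theta_bElem_2, theta_symElem_3, theta_thetaFun_0, theta_thetaFun_1, theta_thetaFun_2, theta_thetaFun_3]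
  ring

/-- `1 · x₂x₄²` in the basis. [OURS · computation] -/
theorem straight_0_4 : bElem k 0 * symElem k 4 = thetaPow k ![0, 0, 0, 0] * bElem k 4 := by
  apply theta_injective
  simp only [map_mul, map_pow, thetaPow_explicit, theta_bElem_0, theta_bElem_4, theta_symElem_4, theta_thetaFun_0, theta_thetaFun_1, theta_thetaFun_2, theta_thetaFun_3]
  ring

/-- `1 · x₁x₂x₄` in the basis. [OURS · computation] -/
theorem straight_0_5 : bElem k 0 * symElem k 5 = thetaPow k ![0, 0, 0, 1] * bElem k 0 := by
  apply theta_injective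
  simp only [map_mul, map_pow, thetaPow_explicit, theta_bElem_0, theta_symElem_5, theta_thetaFun_0, theta_thetaFun_1, theta_thetaFun_2, theta_thetaFun_3]
  ring

/-- `1 · x₁x₂x₃` in the basis. [OURS · computation] -/
theorem straight_0_6 : bElem k 0 * symElem k 6 = thetaPow k ![0, 0, 0, 0] * bElem k 1 := by
  apply theta_injective
  simp only [map_mul, map_pow, thetaPow_explicit, theta_bElem_0, theta_bElem_1, theta_symElem_6, theta_thetaFun_0, theta_thetaFun_1, theta_thetaFun_2, theta_thetaFun_3]
  ring

/-- `x₁x₂x₃ · x₁` in the basis. [OURS · computation] -/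
theorem straight_1_0 : bElem k 1 * symElem k 0 = thetaPow k ![1, 0, 0, 0] * bElem k 1 - thetaPow k ![0, 0, 0, 0] * bElem k 3 := by
  apply theta_injective
  simp only [map_mul, map_pow, map_sub, thetaPow_explicit, theta_bElem_1, theta_bElem_3, theta_symElem_0, theta_thetaFun_0, theta_thetaFun_1, theta_thetaFun_2, theta_thetaFun_3]
  ring

/-- `x₁x₂x₃ · x₃` in the basis. [OURS · computation] -/
theorem straight_1_1 : bElem k 1 * symElem k 1 = thetaPow k ![0, 1, 0, 0] * bElem k 1 - thetaPow k ![0, 0, 0, 1] * bElem k 2 := by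
  apply theta_injective
  simp only [map_mul, map_pow, map_sub, thetaPow_explicit, theta_bElem_1, theta_bElem_2, theta_symElem_1, theta_thetaFun_0, theta_thetaFun_1, theta_thetaFun_2, theta_thetaFun_3]
  ring

/-- `x₁x₂x₃ · x₄` in the basis. [OURS · computation] -/
theorem straight_1_2 : bElem k 1 * symElem k 2 = thetaPow k ![0, 1, 0, 1] * bElem k 0 - thetaPow k ![0, 0, 0, 1] * bElem k 4 := by
  apply theta_injective
  simp only [map_mul, map_pow, map_sub, thetaPow_explicit, theta_bElem_0, theta_bElem_1, theta_bElem_4, theta_symElem_2, theta_thetaFun_0, theta_thetaFun_1, theta_thetaFun_2, theta_thetaFun_3]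
  ring

/-- `x₁x₂x₃ · x₂x₃x₄` in the basis. [OURS · computation] -/
theorem straight_1_3 : bElem k 1 * symElem k 3 = thetaPow k ![0, 0, 0, 0] * bElem k 3 := by
  apply theta_injective
  simp only [map_mul, map_pow, thetaPow_explicit, theta_bElem_1, theta_bElem_3, theta_symElem_3, theta_thetaFun_0, theta_thetaFun_1, theta_thetaFun_2, theta_thetaFun_3]
  ring

/-- `x₁x₂x₃ · x₂x₄²` in the basis. [OURS · computation] -/
theorem straight_1_4 : bElem k 1 * symElem k 4 = thetaPow k ![0, 0, 0, 1] * bElem k 2 := by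
  apply theta_injective
  simp only [map_mul, map_pow, thetaPow_explicit, theta_bElem_1, theta_bElem_2, theta_symElem_4, theta_thetaFun_0, theta_thetaFun_1, theta_thetaFun_2, theta_thetaFun_3]
  ring

/-- `x₁x₂x₃ · x₁x₂x₄` in the basis. [OURS · computation] -/
theorem straight_1_5 : bElem k 1 * symElem k 5 = thetaPow k ![0, 0, 0, 1] * bElem k 1 := by
  apply theta_injective
  simp only [map_mul, map_pow, thetaPow_explicit, theta_bElem_1, theta_symElem_5, theta_thetaFun_0, theta_thetaFun_1, theta_thetaFun_2, theta_thetaFun_3]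
  ring

/-- `x₁x₂x₃ · x₁x₂x₃` in the basis. [OURS · computation] -/
theorem straight_1_6 : bElem k 1 * symElem k 6 = -(thetaPow k ![0, 1, 0, 1] * bElem k 0) + thetaPow k ![0, 0, 1, 0] * bElem k 1 + thetaPow k ![0, 0, 0, 1] * bElem k 4 := by
  apply theta_injective
  simp only [map_mul, map_pow, map_neg, map_add, thetaPow_explicit, theta_bElem_0, theta_bElem_1, theta_bElem_4, theta_symElem_6, theta_thetaFun_0, theta_thetaFun_1, theta_thetaFun_2, theta_thetaFun_3]
  ring

/-- `x₂x₃x₄ · x₁` in the basis. [OURS · computation] -/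
theorem straight_2_0 : bElem k 2 * symElem k 0 = thetaPow k ![0, 1, 0, 1] * bElem k 0 - thetaPow k ![0, 0, 0, 1] * bElem k 4 := by
  apply theta_injective
  simp only [map_mul, map_pow, map_sub, thetaPow_explicit, theta_bElem_0, theta_bElem_2, theta_bElem_4, theta_symElem_0, theta_thetaFun_0, theta_thetaFun_1, theta_thetaFun_2, theta_thetaFun_3]
  ring

/-- `x₂x₃x₄ · x₃` in the basis. [OURS · computation] -/
theorem straight_2_1 : bElem k 2 * symElem k 1 = thetaPow k ![0, 0, 1, 1] * bElem k 0 - thetaPow k ![0, 0, 0, 1] * bElem k 1 + thetaPow k ![0, 1, 0, 0] * bElem k 2 - thetaPow k ![1, 0, 0, 0] * bElem k 4 := by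
  apply theta_injective
  simp only [map_mul, map_pow, map_add, map_sub, thetaPow_explicit, theta_bElem_0, theta_bElem_1, theta_bElem_2, theta_bElem_4, theta_symElem_1, theta_thetaFun_0, theta_thetaFun_1, theta_thetaFun_2, theta_thetaFun_3]
  ring

/-- `x₂x₃x₄ · x₄` in the basis. [OURS · computation] -/
theorem straight_2_2 : bElem k 2 * symElem k 2 = thetaPow k ![0, 0, 1, 0] * bElem k 2 - thetaPow k ![0, 0, 0, 0] * bElem k 3 := by
  apply theta_injective
  simp only [map_mul, map_pow, map_sub, thetaPow_explicit, theta_bElem_2, theta_bElem_3, theta_symElem_2, theta_thetaFun_0, theta_thetaFun_1, theta_thetaFun_2, theta_thetaFun_3]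
  ring

/-- `x₂x₃x₄ · x₂x₃x₄` in the basis. [OURS · computation] -/
theorem straight_2_3 : bElem k 2 * symElem k 3 = -(thetaPow k ![0, 1, 0, 1] * bElem k 0) + thetaPow k ![1, 0, 0, 0] * bElem k 2 + thetaPow k ![0, 0, 0, 1] * bElem k 4 := by
  apply theta_injective
  simp only [map_mul, map_pow, map_neg, map_add, thetaPow_explicit, theta_bElem_0, theta_bElem_2, theta_bElem_4, theta_symElem_3, theta_thetaFun_0, theta_thetaFun_1, theta_thetaFun_2, theta_thetaFun_3]
  ring

/-- `x₂x₃x₄ · x₂x₄²` in the basis. [OURS · computation] -/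
theorem straight_2_4 : bElem k 2 * symElem k 4 = -(thetaPow k ![0, 0, 1, 1] * bElem k 0) + thetaPow k ![0, 0, 0, 1] * bElem k 1 + thetaPow k ![1, 0, 0, 0] * bElem k 4 := by
  apply theta_injective
  simp only [map_mul, map_pow, map_neg, map_add, thetaPow_explicit, theta_bElem_0, theta_bElem_1, theta_bElem_2, theta_bElem_4, theta_symElem_4, theta_thetaFun_0, theta_thetaFun_1, theta_thetaFun_2, theta_thetaFun_3]
  ring

/-- `x₂x₃x₄ · x₁x₂x₄` in the basis. [OURS · computation] -/
theorem straight_2_5 : bElem k 2 * symElem k 5 = thetaPow k ![0, 0, 0, 1] * bElem k 2 := by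
  apply theta_injective
  simp only [map_mul, map_pow, thetaPow_explicit, theta_bElem_2, theta_symElem_5, theta_thetaFun_0, theta_thetaFun_1, theta_thetaFun_2, theta_thetaFun_3]
  ring

/-- `x₂x₃x₄ · x₁x₂x₃` in the basis. [OURS · computation] -/
theorem straight_2_6 : bElem k 2 * symElem k 6 = thetaPow k ![0, 0, 0, 0] * bElem k 3 := by
  apply theta_injective
  simp only [map_mul, map_pow, thetaPow_explicit, theta_bElem_2, theta_bElem_3, theta_symElem_6, theta_thetaFun_0, theta_thetaFun_1, theta_thetaFun_2, theta_thetaFun_3]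
  ring

/-- `x₁x₂²x₃²x₄ · x₁` in the basis. [OURS · computation] -/
theorem straight_3_0 : bElem k 3 * symElem k 0 = thetaPow k ![0, 1, 0, 1] * bElem k 1 - thetaPow k ![0, 0, 0, 2] * bElem k 2 := by
  apply theta_injective
  simp only [map_mul, map_pow, map_sub, thetaPow_explicit, theta_bElem_1, theta_bElem_2, theta_bElem_3, theta_symElem_0, theta_thetaFun_0, theta_thetaFun_1, theta_thetaFun_2, theta_thetaFun_3]
  ring

/-- `x₁x₂²x₃²x₄ · x₃` in the basis. [OURS · computation] -/
theorem straight_3_1 : bElem k 3 * symElem k 1 = thetaPow k ![0, 1, 0, 2] * bElem k 0 - thetaPow k ![1, 0, 0, 1] * bElem k 2 + thetaPow k ![0, 1, 0, 0] * bElem k 3 - thetaPow k ![0, 0, 0, 2] * bElem k 4 := by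
  apply theta_injective
  simp only [map_mul, map_pow, map_add, map_sub, thetaPow_explicit, theta_bElem_0, theta_bElem_2, theta_bElem_3, theta_bElem_4, theta_symElem_1, theta_thetaFun_0, theta_thetaFun_1, theta_thetaFun_2, theta_thetaFun_3]
  ring

/-- `x₁x₂²x₃²x₄ · x₄` in the basis. [OURS · computation] -/
theorem straight_3_2 : bElem k 3 * symElem k 2 = thetaPow k ![0, 0, 1, 2] * bElem k 0 - thetaPow k ![0, 0, 0, 2] * bElem k 1 + thetaPow k ![0, 1, 0, 1] * bElem k 2 - thetaPow k ![1, 0, 0, 1] * bElem k 4 := by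
  apply theta_injective
  simp only [map_mul, map_pow, map_add, map_sub, thetaPow_explicit, theta_bElem_0, theta_bElem_1, theta_bElem_2, theta_bElem_3, theta_bElem_4, theta_symElem_2, theta_thetaFun_0, theta_thetaFun_1, theta_thetaFun_2, theta_thetaFun_3]
  ring

/-- `x₁x₂²x₃²x₄ · x₂x₃x₄` in the basis. [OURS · computation] -/
theorem straight_3_3 : bElem k 3 * symElem k 3 = -(thetaPow k ![0, 1, 0, 1] * bElem k 1) + thetaPow k ![0, 0, 0, 2] * bElem k 2 + thetaPow k ![1, 0, 0, 0] * bElem k 3 := by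
  apply theta_injective
  simp only [map_mul, map_pow, map_neg, map_add, thetaPow_explicit, theta_bElem_1, theta_bElem_2, theta_bElem_3, theta_symElem_3, theta_thetaFun_0, theta_thetaFun_1, theta_thetaFun_2, theta_thetaFun_3]
  ring

/-- `x₁x₂²x₃²x₄ · x₂x₄²` in the basis. [OURS · computation] -/
theorem straight_3_4 : bElem k 3 * symElem k 4 = -(thetaPow k ![0, 1, 0, 2] * bElem k 0) + thetaPow k ![1, 0, 0, 1] * bElem k 2 + thetaPow k ![0, 0, 0, 2] * bElem k 4 := by
  apply theta_injective
  simp only [map_mul, map_pow, map_neg, map_add, thetaPow_explicit, theta_bElem_0, theta_bElem_2, theta_bElem_3, theta_bElem_4, theta_symElem_4, theta_thetaFun_0, theta_thetaFun_1, theta_thetaFun_2, theta_thetaFun_3]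
  ring

/-- `x₁x₂²x₃²x₄ · x₁x₂x₄` in the basis. [OURS · computation] -/
theorem straight_3_5 : bElem k 3 * symElem k 5 = thetaPow k ![0, 0, 0, 1] * bElem k 3 := by
  apply theta_injective
  simp only [map_mul, map_pow, thetaPow_explicit, theta_bElem_3, theta_symElem_5, theta_thetaFun_0, theta_thetaFun_1, theta_thetaFun_2, theta_thetaFun_3]
  ring

/-- `x₁x₂²x₃²x₄ · x₁x₂x₃` in the basis. [OURS · computation] -/
theorem straight_3_6 : bElem k 3 * symElem k 6 = -(thetaPow k ![0, 0, 1, 2] * bElem k 0) + thetaPow k ![0, 0, 0, 2] * bElem k 1 - thetaPow k ![0, 1, 0, 1] * bElem k 2 + thetaPow k ![0, 0, 1, 0] * bElem k 3 + thetaPow k ![1, 0, 0, 1] * bElem k 4 := by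
  apply theta_injective
  simp only [map_mul, map_pow, map_neg, map_add, map_sub, thetaPow_explicit, theta_bElem_0, theta_bElem_1, theta_bElem_2, theta_bElem_3, theta_bElem_4, theta_symElem_6, theta_thetaFun_0, theta_thetaFun_1, theta_thetaFun_2, theta_thetaFun_3]
  ring

/-- `x₂x₄² · x₁` in the basis. [OURS · computation] -/
theorem straight_4_0 : bElem k 4 * symElem k 0 = thetaPow k ![0, 0, 1, 1] * bElem k 0 - thetaPow k ![0, 0, 0, 1] * bElem k 1 := by
  apply theta_injective
  simp only [map_mul, map_pow, map_sub, thetaPow_explicit, theta_bElem_0, theta_bElem_1, theta_bElem_4, theta_symElem_0, theta_thetaFun_0, theta_thetaFun_1, theta_thetaFun_2, theta_thetaFun_3]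
  ring

/-- `x₂x₄² · x₃` in the basis. [OURS · computation] -/
theorem straight_4_1 : bElem k 4 * symElem k 1 = thetaPow k ![0, 0, 1, 0] * bElem k 2 - thetaPow k ![0, 0, 0, 0] * bElem k 3 := by
  apply theta_injective
  simp only [map_mul, map_pow, map_sub, thetaPow_explicit, theta_bElem_2, theta_bElem_3, theta_bElem_4, theta_symElem_1, theta_thetaFun_0, theta_thetaFun_1, theta_thetaFun_2, theta_thetaFun_3]
  ring

/-- `x₂x₄² · x₄` in the basis. [OURS · computation] -/
theorem straight_4_2 : bElem k 4 * symElem k 2 = -(thetaPow k ![0, 0, 0, 1] * bElem k 2) + thetaPow k ![0, 0, 1, 0] * bElem k 4 := by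
  apply theta_injective
  simp only [map_mul, map_pow, map_neg, map_add, thetaPow_explicit, theta_bElem_2, theta_bElem_4, theta_symElem_2, theta_thetaFun_0, theta_thetaFun_1, theta_thetaFun_2, theta_thetaFun_3]
  ring

/-- `x₂x₄² · x₂x₃x₄` in the basis. [OURS · computation] -/
theorem straight_4_3 : bElem k 4 * symElem k 3 = -(thetaPow k ![0, 0, 1, 1] * bElem k 0) + thetaPow k ![0, 0, 0, 1] * bElem k 1 + thetaPow k ![1, 0, 0, 0] * bElem k 4 := by
  apply theta_injective
  simp only [map_mul, map_pow, map_neg, map_add, thetaPow_explicit, theta_bElem_0, theta_bElem_1, theta_bElem_4, theta_symElem_3, theta_thetaFun_0, theta_thetaFun_1, theta_thetaFun_2, theta_thetaFun_3]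
  ring

/-- `x₂x₄² · x₂x₄²` in the basis. [OURS · computation] -/
theorem straight_4_4 : bElem k 4 * symElem k 4 = -(thetaPow k ![0, 0, 1, 0] * bElem k 2) + thetaPow k ![0, 0, 0, 0] * bElem k 3 + thetaPow k ![0, 1, 0, 0] * bElem k 4 := by
  apply theta_injective
  simp only [map_mul, map_pow, map_neg, map_add, thetaPow_explicit, theta_bElem_2, theta_bElem_3, theta_bElem_4, theta_symElem_4, theta_thetaFun_0, theta_thetaFun_1, theta_thetaFun_2, theta_thetaFun_3]
  ring

/-- `x₂x₄² · x₁x₂x₄` in the basis. [OURS · computation] -/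
theorem straight_4_5 : bElem k 4 * symElem k 5 = thetaPow k ![0, 0, 0, 1] * bElem k 4 := by
  apply theta_injective
  simp only [map_mul, map_pow, thetaPow_explicit, theta_bElem_4, theta_symElem_5, theta_thetaFun_0, theta_thetaFun_1, theta_thetaFun_2, theta_thetaFun_3]
  ring

/-- `x₂x₄² · x₁x₂x₃` in the basis. [OURS · computation] -/
theorem straight_4_6 : bElem k 4 * symElem k 6 = thetaPow k ![0, 0, 0, 1] * bElem k 2 := by
  apply theta_injective
  simp only [map_mul, map_pow, thetaPow_explicit, theta_bElem_2, theta_bElem_4, theta_symElem_6, theta_thetaFun_0, theta_thetaFun_1, theta_thetaFun_2, theta_thetaFun_3]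
  ring

end Summit.ResolutionOfSingularities.ResolutionOfSingularities.Theorems.FInjectiveMacaulayfication.RMonoidStraightening

end
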